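import Summits.CriticalPhenomena.Ising3DConformalLimit.Theses.HyperoctahedralRP
import Summits.CriticalPhenomena.Ising3DConformalLimit.Theorems.HyperoctahedralRPExistsScaleCovariantLimitDoublingOfDyadicPairRatio
import Summits.CriticalPhenomena.Ising3DConformalLimit.Theorems.HyperoctahedralRPExistsScaleCovariantLimitDecimationDefs
import Summits.CriticalPhenomena.Ising3DConformalLimit.Theorems.HyperoctahedralRPExistsScaleCovariantLimitDecimationEndpointIdentity
import Summits.CriticalPhenomena.Ising3DConformalLimit.Theorems.HyperoctahedralRPExistsScaleCovariantLimitDecimationBoxBridge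
import Summits.CriticalPhenomena.Ising3DConformalLimit.Theorems.HyperoctahedralRPExistsScaleCovariantLimitDecimationCurveEndpoints
import Literature.Probability.LatticeModels.CriticalCorrWellDefined
import Literature.Probability.LatticeModels.PointwiseScalingLimitEtaExists
import HarnessLib

/-!
# `PathLipschitz 2 ∧ PathLipschitz 3 ⟹ ExistsScaleCovariantLimit` — the tail of line `decimation-homotopy-rate`, unconditionally

Crux `Summit.CriticalPhenomena.Ising3DConformalLimit.Theses.HyperoctahedralRP.ExistsScaleCovariantLimit` (item
stmt-CriticalPhenomena-1981, shared by 14 routes), line `decimation-homotopy-rate` (lead `prover-line-stmt-CriticalPhenomena-1981-c8-0`,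
skeleton v3 `Cruxes/ExistsScaleCovariantLimit/Lines/decimation_homotopy_rate.lean`). With the three provable stubs of the line LANDED —
E `stub_endpointIdentity` (p130071), B `stub_boxBridge` (p129928), C `stub_curveEndpoints` (p129855) — everything downstream of the
line's ENGINE CONJECTURE `PathLipschitz p` (local universality with a rate along the susceptibility-critical curve `J = J_χ(K)` of the
two-coupling n.n. `K` + sublattice range-`p` `J` ferromagnet; `Theorems/…DecimationDefs.lean`) is a theorem, collected here sorry-free:

* `freeBoxLimit_holds` — the free-boundary box averages of the n.n. model at `β_c(3)` converge to `criticalCorr 3` (B + the tree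
  theorem `criticalCorr_wellDefined_holds`); `curveEndpoints_holds` — `J_χ(0) = β_c`, `J_χ(β_c) = 0` (C applied to E, B);
* `meshRate_of_pathLipschitz` — `PathLipschitz p` ⟹ `|Z(pL; z) − Z(L; z)| ≤ B·L^{-θ}` for the pinned zoom
  `Z(m;z) = ⟨∏σ_{m zᵢ}⟩_{β_c} ⟨σ₀σ_{me₀}⟩_{β_c}^{-n/2}` of the critical n.n. model at integer meshes (the two ENDPOINTS of the path are the
  meshes `1/(pL)` and `1/L`: `EndpointIdentity` at `K = 0`, `boxAvg_zero_J` at `J = 0`, `FreeBoxLimit` for `N = pM → ∞`);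
* `hierarchy_of_pathLipschitz` — geometric summation: `PathLipschitz p` ⟹ the pinned zoom converges along the meshes `p^{-k}` at every
  non-coincident integer configuration (for `p = 2` the dead line `Sketch`'s residue S2', for `p = 3` its S3');
* `twoPointDoubling_of_pathLipschitz2`, `orbitPrecompact_of_pathLipschitz2` — `PathLipschitz 2` ALONE pays items 6150 `TwoPointDoubling` and
  5955 `OrbitPrecompact` (landed D6 `TwoHierarchies.twoPointDoubling_of_dyadicIntConvergence` / `orbitPrecompact_of_dyadicIntConvergence`, p123864);
* `ExistsScaleCovariantLimit_of_pathLipschitz` — **`PathLipschitz 2 → PathLipschitz 3 → ExistsScaleCovariantLimit`** (landed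
  `TwoHierarchies.crux_iff_dyadicInt_triadicInt`: two hierarchies force the filter, compactness included). This is the registered
  sub-goal of the item; the skeleton's `ExistsScaleCovariantLimit_of` is this theorem.

Nothing here asserts `PathLipschitz p` (open: an irrelevance estimate at `ε = 1`; `RigorousRGSmallParameter` bites in spirit).
Sources: L. P. Kadanoff, Physics 2 (1966) 263; Duminil-Copin, ICM 2022 §8.4; Aizenman–Duminil-Copin, Ann. Math. 194 (2021) Rem. 5.10.
-/

noncomputable section

open Filter Topology
open scoped BigOperators
open Literature.Probability.LatticeModels
open Summit.CriticalPhenomena.Ising3DConformalLimit.MoebiusLimitExistsOnlyInteraction (rhoPin)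
open Summit.CriticalPhenomena.Ising3DConformalLimit.Theses
open Classical

namespace Summit.CriticalPhenomena.Ising3DConformalLimit.Cruxes.ExistsScaleCovariantLimit.DecimationHomotopyRate

/-! ## Endpoints of the path = the critical pinned zoom at meshes `1/(pL)` and `1/L` -/

/-- `criticalCorr 3 2 (0, m e₀) = ⟨σ₀σ_{m e₀}⟩_{β_c}`. [folklore] -/
theorem criticalCorr_axisPair (m : ℕ) :
    criticalCorr 3 2 (axisPair m) = criticalTwoPoint 3 (Pi.single 0 (m : ℤ)) :=
  criticalCorr_two 3 _

/-- `(p^k)^{-θ} = (p^{-θ})^k` for the geometric summation. [folklore] -/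
theorem natCast_pow_rpow_neg (p k : ℕ) (θ : ℝ) :
    ((p ^ k : ℕ) : ℝ) ^ (-θ) = ((p : ℝ) ^ (-θ)) ^ k := by
  have hp0 : (0 : ℝ) ≤ p := Nat.cast_nonneg p
  rw [Nat.cast_pow, ← Real.rpow_natCast ((p : ℝ) ^ (-θ)) k, ← Real.rpow_mul hp0, mul_comm,
    Real.rpow_mul hp0, Real.rpow_natCast]

/-- Every site of a configuration lies in the box `Λ_N` eventually in `N`. [folklore] -/
theorem eventually_forall_mem_box {n : ℕ} (x : Fin n → Site 3) : ∀ᶠ N : ℕ in atTop, ∀ i, x i ∈ box 3 N :=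
  eventually_all.2 fun i => eventually_mem_box (x i)

/-- **FREE BOX LIMIT from the bridge** (glue, v2): `BoxBridge` and the tree theorem `criticalCorr_wellDefined_holds`
(`d = 3`, free boundary condition; Friedli–Velenik Thm. 3.17/3.28 + ADS 2015 `m*(β_c) = 0`) give `FreeBoxLimit`. [folklore] -/
theorem freeBoxLimit_of_bridge (hB : BoxBridge) : FreeBoxLimit := by
  intro n x
  have hwd := criticalCorr_wellDefined_holds (d := 3) le_rfl n x .free (by simp)
  refine (hwd.congr' ?_)
  filter_upwards [eventually_forall_mem_box x] with N hN
  exact (hB N (criticalBeta 3) n x hN).symm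

/-- **The tree's pinned zoom at an integer mesh `1/m` and an integer configuration is `latticeZoom`** (no
lattice sawtooth: `⌊zᵢⱼ · m⌋ = m zᵢⱼ`, `⌊1/(1/m)⌋ = m`). [folklore] -/
theorem rescaledCorrelator_intMesh {n : ℕ} (y : Fin n → EuclideanSpace ℝ (Fin 3)) (z : Fin n → Site 3)
    (hz : ∀ i j, y i j = (z i j : ℝ)) (m : ℕ) :
    rescaledCorrelator (criticalCorr 3) rhoPin n ((m : ℝ)⁻¹) y = latticeZoom n m z := by
  rw [rescaledCorrelator_apply, latticeZoom]
  congr 1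
  · congr 1
    simp only [rhoPin, one_div, inv_inv, Int.floor_natCast]
  · congr 1
    funext i j
    rw [latticeApprox_apply, hz i j, div_inv_eq_mul, Pi.smul_apply, smul_eq_mul]
    have e : (z i j : ℝ) * (m : ℝ) = ((z i j * (m : ℤ) : ℤ) : ℝ) := by push_cast; ring
    rw [e, Int.floor_intCast]
    ring

/-- **MESH RATE** — the two endpoints of `PathLipschitz p`, read through `CurveEndpoints`,
`EndpointIdentity` (at `K = 0`, volumes `N = pM`, `⌊pM/p⌋ = M`), `decimationCoupling_zero_J` (at `J = 0`) and
`FreeBoxLimit`: consecutive integer meshes in ratio `p` have pinned zooms within `B · L^{-θ}`. [folklore] -/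
theorem meshRate {p : ℕ} (hp : 2 ≤ p) (hE : EndpointIdentity p) (hF : FreeBoxLimit)
    (hC : CurveEndpoints p) (hP : PathLipschitz p) (n : ℕ) (z : Fin n → Site 3)
    (hz : Function.Injective z) :
    ∃ θ : ℝ, 0 < θ ∧ ∃ B : ℝ, ∀ L : ℕ, 1 ≤ L →
      |latticeZoom n (p * L) z - latticeZoom n L z| ≤ B * (L : ℝ) ^ (-θ) := by
  obtain ⟨θ, hθ, C, hC'⟩ := hP n z hz
  refine ⟨θ, hθ, C * (|criticalBeta 3 - 0| + |(0 : ℝ) - criticalBeta 3|), fun L hL => ?_⟩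
  have hβ : 0 ≤ criticalBeta 3 := criticalBeta_nonneg 3
  obtain ⟨N₀, hN₀⟩ := hC' L hL (criticalBeta 3) ⟨hβ, le_rfl⟩ 0 ⟨le_rfl, hβ⟩
  rw [hC.2, hC.1] at hN₀
  have hpos : 0 < p := by omega
  have hsub : Tendsto (fun M : ℕ => p * M) atTop atTop :=
    tendsto_atTop_mono (fun M => Nat.le_mul_of_pos_left M hpos) tendsto_id
  -- (a) the `J = 0` end: the n.n. model at `β_c` in the volume `Λ_{pM}`, sites `pL zᵢ`, pair `(0, pL e₀)`
  have hA : Tendsto (fun M : ℕ => finZoom p (p * M) (criticalBeta 3) 0 n L z) atTop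
      (𝓝 (latticeZoom n (p * L) z)) := by
    have h1 : Tendsto (fun M : ℕ => boxAvg p (p * M) (criticalBeta 3) 0 (axisPair (p * L))) atTop
        (𝓝 (criticalTwoPoint 3 (Pi.single 0 ((p * L : ℕ) : ℤ)))) := by
      rw [← criticalCorr_axisPair]
      exact ((hF 2 (axisPair (p * L))).comp hsub).congr fun M => (boxAvg_zero_J p (p * M) _ _).symm
    have h2 : Tendsto (fun M : ℕ => boxAvg p (p * M) (criticalBeta 3) 0 (fun i => ((p * L : ℕ) : ℤ) • z i))
        atTop (𝓝 (criticalCorr 3 n (fun i => ((p * L : ℕ) : ℤ) • z i))) :=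
      ((hF n _).comp hsub).congr fun M => (boxAvg_zero_J p (p * M) _ _).symm
    exact ((h1.rpow_const (Or.inl (criticalTwoPoint_axis_pos _).ne')).pow n).mul h2
  -- (b) the `K = 0` end: by the endpoint identity, the n.n. model at `β_c` in `Λ_M`, sites `L zᵢ`, pair `(0, L e₀)`
  have hB : Tendsto (fun M : ℕ => finZoom p (p * M) 0 (criticalBeta 3) n L z) atTop
      (𝓝 (latticeZoom n L z)) := by
    have h1 : Tendsto (fun M : ℕ => boxAvg p (p * M) 0 (criticalBeta 3) (axisPair (p * L))) atTop
        (𝓝 (criticalTwoPoint 3 (Pi.single 0 (L : ℤ)))) := by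
      rw [← criticalCorr_axisPair]
      refine (hF 2 (axisPair L)).congr fun M => ?_
      rw [← smul_axisPair p L, hE, Nat.mul_div_cancel_left M hpos]
    have h2 : Tendsto (fun M : ℕ => boxAvg p (p * M) 0 (criticalBeta 3) (fun i => ((p * L : ℕ) : ℤ) • z i))
        atTop (𝓝 (criticalCorr 3 n (fun i => (L : ℤ) • z i))) := by
      refine (hF n (fun i => (L : ℤ) • z i)).congr fun M => ?_
      rw [← smul_smul_cfg p L z, hE, Nat.mul_div_cancel_left M hpos]
    exact ((h1.rpow_const (Or.inl (criticalTwoPoint_axis_pos _).ne')).pow n).mul h2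
  -- (c) pass to the limit in the finite-volume bound along `N = pM ≥ N₀`
  have hev : ∀ᶠ M : ℕ in atTop,
      |finZoom p (p * M) (criticalBeta 3) 0 n L z - finZoom p (p * M) 0 (criticalBeta 3) n L z| ≤
        C * (L : ℝ) ^ (-θ) * (|criticalBeta 3 - 0| + |(0 : ℝ) - criticalBeta 3|) :=
    eventually_atTop.2 ⟨N₀, fun M hM => hN₀ (p * M) (hM.trans (Nat.le_mul_of_pos_left M hpos))⟩
  calc |latticeZoom n (p * L) z - latticeZoom n L z|
      ≤ C * (L : ℝ) ^ (-θ) * (|criticalBeta 3 - 0| + |(0 : ℝ) - criticalBeta 3|) :=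
        le_of_tendsto ((hA.sub hB).abs) hev
    _ = C * (|criticalBeta 3 - 0| + |(0 : ℝ) - criticalBeta 3|) * (L : ℝ) ^ (-θ) := by ring

/-- **ONE HIERARCHY FROM THE STUBS AT ONE `p`**: `E ∧ F ∧ C ∧ PathLipschitz p` give convergence of the
pinned zoom along the meshes `p^{-k}` at every integer configuration (geometric summation of `meshRate`;
`ℝ` is complete). For `p = 2` this is S2' (`stub_dyadicIntConvergence` of the dead line `Sketch`), for
`p = 3` it is S3'. [folklore] -/
theorem hierarchy_of_stubs {p : ℕ} (hp : 2 ≤ p) (hE : EndpointIdentity p) (hF : FreeBoxLimit)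
    (hC : CurveEndpoints p) (hP : PathLipschitz p) :
    ∀ (n : ℕ) (y : Fin n → EuclideanSpace ℝ (Fin 3)), y ∈ NonCoincident 3 n →
      (∀ i j, ∃ z : ℤ, y i j = (z : ℝ)) →
      ∃ Lim : ℝ, Tendsto (fun k : ℕ => rescaledCorrelator (criticalCorr 3) rhoPin n (((p : ℝ) ^ k)⁻¹) y)
        atTop (𝓝 Lim) := by
  intro n y hy hint
  choose z hz using hint
  -- `y` non-coincident ⟹ its integer version `z` is injective
  have hzinj : Function.Injective z := fun i i' h =>
    hy (PiLp.ext fun j => by rw [hz i j, hz i' j, h])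
  obtain ⟨θ, hθ, B, hB⟩ := meshRate hp hE hF hC hP n z hzinj
  have hp1 : (1 : ℝ) < p := by exact_mod_cast hp
  have hr : (p : ℝ) ^ (-θ) < 1 := Real.rpow_lt_one_of_one_lt_of_neg hp1 (by linarith)
  -- geometric Cauchy estimate along `L = p^k`
  have hdist : ∀ k : ℕ, dist (latticeZoom n (p ^ k) z) (latticeZoom n (p ^ (k + 1)) z) ≤
      B * ((p : ℝ) ^ (-θ)) ^ k := by
    intro k
    rw [Real.dist_eq, abs_sub_comm, pow_succ', ← natCast_pow_rpow_neg]
    exact hB (p ^ k) (Nat.one_le_pow k p (by omega))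
  obtain ⟨Lim, hLim⟩ := cauchySeq_tendsto_of_complete
    (cauchySeq_of_le_geometric ((p : ℝ) ^ (-θ)) B hr hdist)
  refine ⟨Lim, hLim.congr fun k => ?_⟩
  rw [← rescaledCorrelator_intMesh y z hz (p ^ k), Nat.cast_pow]


/-! ## The landed stubs discharge E, F (= FreeBoxLimit), C -/

/-- **F holds**: the free-boundary box averages of the n.n. model at `β_c(3)` converge to the critical state (stub B p129928 +
`criticalCorr_wellDefined_holds`). [cite: AizenmanDuminilCopinSidoraviciusCMP2015, Thm. 1.2 with Cor. 1.5 (1)] -/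
theorem freeBoxLimit_holds : FreeBoxLimit := freeBoxLimit_of_bridge stub_boxBridge

/-- **C holds**: `J_χ(0) = β_c(3)` and `J_χ(β_c(3)) = 0` for every period `p ≥ 2` (stub C p129855 applied to stubs E p130071, B p129928).
[cite: AizenmanBarskyFernandezJSP1987, Thm. 1] -/
theorem curveEndpoints_holds {p : ℕ} (hp : 2 ≤ p) : CurveEndpoints p :=
  stub_curveEndpoints stub_endpointIdentity stub_boxBridge p hp

/-- **MESH RATE from `PathLipschitz p` alone** (E, F, C discharged): `|Z(pL; z) − Z(L; z)| ≤ B · L^{-θ}` at every injective integer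
configuration. [folklore] -/
theorem meshRate_of_pathLipschitz {p : ℕ} (hp : 2 ≤ p) (hP : PathLipschitz p) (n : ℕ) (z : Fin n → Site 3)
    (hz : Function.Injective z) :
    ∃ θ : ℝ, 0 < θ ∧ ∃ B : ℝ, ∀ L : ℕ, 1 ≤ L →
      |latticeZoom n (p * L) z - latticeZoom n L z| ≤ B * (L : ℝ) ^ (-θ) :=
  meshRate hp (stub_endpointIdentity p hp) freeBoxLimit_holds (curveEndpoints_holds hp) hP n z hz

/-- **ONE HIERARCHY from `PathLipschitz p` alone**: the pinned zoom of the critical n.n. model converges along the meshes `p^{-k}` at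
every non-coincident integer configuration (`p = 2`: the dead line `Sketch`'s S2'; `p = 3`: its S3'). [folklore] -/
theorem hierarchy_of_pathLipschitz {p : ℕ} (hp : 2 ≤ p) (hP : PathLipschitz p) :
    ∀ (n : ℕ) (y : Fin n → EuclideanSpace ℝ (Fin 3)), y ∈ NonCoincident 3 n →
      (∀ i j, ∃ z : ℤ, y i j = (z : ℝ)) →
      ∃ Lim : ℝ, Tendsto (fun k : ℕ => rescaledCorrelator (criticalCorr 3) rhoPin n (((p : ℝ) ^ k)⁻¹) y)
        atTop (𝓝 Lim) :=
  hierarchy_of_stubs hp (stub_endpointIdentity p hp) freeBoxLimit_holds (curveEndpoints_holds hp) hP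

/-- **`PathLipschitz 2` ALONE ⟹ item 6150 `TwoPointDoubling`** (all-scale axis doubling of `⟨σ₀σ_x⟩_{β_c}` on `ℤ³`, open — ADC 2021
Rem. 5.10): the dyadic hierarchy at `n = 2`, `y = (0, 2e₀)` through the landed D6. [cite: AizenmanDuminilCopinAnnals2021, arXiv:1912.07973 Remark 5.10] -/
theorem twoPointDoubling_of_pathLipschitz2 (hP : PathLipschitz 2) : MirrorHoelderCompactness.TwoPointDoubling :=
  TwoHierarchies.twoPointDoubling_of_dyadicIntConvergence fun n y hy hint => by
    simpa using hierarchy_of_pathLipschitz (p := 2) le_rfl hP n y hy hint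

/-- **`PathLipschitz 2` ALONE ⟹ item 5955 `OrbitPrecompact`** (precompactness of the critical zoom orbit at all orders).
[cite: DuminilCopinICM2022, §8.4 p. 29] -/
theorem orbitPrecompact_of_pathLipschitz2 (hP : PathLipschitz 2) : MonotoneRG.OrbitPrecompact :=
  TwoHierarchies.orbitPrecompact_of_dyadicIntConvergence fun n y hy hint => by
    simpa using hierarchy_of_pathLipschitz (p := 2) le_rfl hP n y hy hint

/-- **`PathLipschitz 2 → PathLipschitz 3 → ExistsScaleCovariantLimit`** — the crux of 14 routes from the line's engine conjecture at
the two primes `2, 3` and NOTHING ELSE (registered sub-goal `ExistsScaleCovariantLimit_of_pathLipschitz`; tail = landed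
`TwoHierarchies.crux_iff_dyadicInt_triadicInt`, p123864). [cite: DuminilCopinICM2022, §8.4 p. 29] -/
theorem ExistsScaleCovariantLimit_of_pathLipschitz :
    PathLipschitz 2 → PathLipschitz 3 →
      Summit.CriticalPhenomena.Ising3DConformalLimit.Theses.HyperoctahedralRP.ExistsScaleCovariantLimit := by
  intro h2 h3
  refine TwoHierarchies.crux_iff_dyadicInt_triadicInt.2 ⟨fun n y hy hint => ?_, fun n y hy hint => ?_⟩
  · simpa using hierarchy_of_pathLipschitz (p := 2) le_rfl h2 n y hy hint
  · simpa using hierarchy_of_pathLipschitz (p := 3) (by norm_num) h3 n y hy hint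

end Summit.CriticalPhenomena.Ising3DConformalLimit.Cruxes.ExistsScaleCovariantLimit.DecimationHomotopyRate

end
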